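import Summits.CriticalPhenomena.PercolationContinuityZ3.Theorems.SoloInformedSlabCriticalDensity
import HarnessLib

/-!
# `θ(p_c) = 0` on `ℤ³` as the vanishing of finite-volume / finite-width probabilities along the
# slab-critical staircase

Write `C_k = {-k ≤ x₀ ≤ k}` (`cslab k`) for the centred slab of half-width `k`, `p_k := p_c(C_k)`
for its critical point (`p_k ↓ p_c(ℤ³)`, Grimmett–Marstrand, `tendsto_criticalProb_cslab`) and
`a_k := θ_{ℤ³}(p_k)`. The file `SoloInformedSlabCriticalDensity` proves `θ(p_c) = 0 ↔ a_k → 0`.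
Here the infinite-volume quantity `a_k` is replaced by two probabilities of LOCAL events evaluated
at the explicit parameters `p_k`:

* `percolationContinuityZ3_iff_tendsto_oneArm_slabCritical` —
  **`θ(p_c) = 0 ↔ P_{p_k}(0 ↔ ∂Λ_k) → 0`**: the one-arm probability at scale `k`, at the critical
  point of the slab of half-width `k`, tends to `0`. This is the case `q_k = p_k`, `n_k = k` of the
  general `theta_eq_zero_iff_tendsto_real_siteToBoundary`: for ANY parameters `q_k → p₀` with
  `q_k ≥ p₀` and ANY scales `n_k → ∞`, `θ(p₀) = 0 ↔ P_{q_k}(0 ↔ ∂Λ_{n_k}) → 0` on `ℤ^d`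
  ((→): a fixed scale `K` with `P_{p₀}(0 ↔ ∂Λ_K) < ε/2`, continuity of the local event in the
  parameter, monotonicity in the scale; (←): `θ(p₀) ≤ θ(q_k) ≤ P_{q_k}(0 ↔ ∂Λ_{n_k})`).
* `percolationContinuityZ3_iff_tendsto_real_slabCross` —
  **`θ(p_c) = 0 ↔ P_{p_k}(0 ↔ ∂C_k in C_k) → 0`**, where `slabCross k = {0 ↔ ∂C_k in C_k}` is the
  event that the centre of the slab is joined INSIDE the slab to one of its two faces `{x₀ = ±k}`:
  a statement about the family of slabs AT THEIR OWN CRITICAL POINTS only (where `θ_{C_k} = 0` is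
  the Duminil-Copin–Sidoravicius–Tassion theorem, `theta_cslab_criticalProb_eq_zero`): the critical
  slab cluster of the centre, which is almost surely finite, touches the faces with probability
  tending to `0` as the width grows.
  The sandwich behind it (`theta_slabCritical_le_real_slabCross`,
  `real_slabCross_le_real_siteToBoundary`): for `k ≥ 1`,
  `θ(p_c) ≤ a_k ≤ P_{p_k}(0 ↔ ∂C_k in C_k) ≤ P_{p_k}(0 ↔ ∂Λ_k)`.
  The middle inequality is the deterministic `{0 ↔ ∞} ⊆ {0 ↔ ∞ in C_k} ∪ {0 ↔ ∂C_k in C_k}`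
  (`mem_slabCross_of_percolatesAt_of_notMem_slabPerc`: the first edge of an infinite open path
  leaving the slab cluster of `0` leaves the slab, so its tail lies on a face), which gives
  `θ_{ℤ³}(p) - θ_{C_k}(p) ≤ P_p(0 ↔ ∂C_k in C_k)` at every `p`
  (`theta_sub_theta_cslab_le_real_slabCross`), and DST kills `θ_{C_k}(p_k)`.

In the jump world (`θ(p_c) > 0`) both sequences are bounded below by `θ(p_c)`
(`theta_criticalProbI_le_real_slabCross`). Solo seat `solo-CriticalPhenomena-informed`, census
`paper/sharpest-statement.md` §7 (equivalent forms #11, #12): faithful reformulations, not weakenings.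

References: G. Grimmett, *Percolation* (1999), §1.4 (`θ(p) ≤ P_p(0 ↔ ∂B(n))`), Thm. (7.2) p. 148,
Lemma (8.9) p. 203; H. Duminil-Copin, V. Sidoravicius, V. Tassion, CPAM 69 (2016), arXiv:1401.7130,
Thm. 1; H. Duminil-Copin, V. Tassion, Enseign. Math. 62 (2016), arXiv:1502.03051, §2.
-/

noncomputable section

namespace Summit.CriticalPhenomena.PercolationContinuityZ3.Theorems

open MeasureTheory Filter Topology
open Literature.Probability.Percolation Literature.Probability.LatticeModels
open Literature.Barriers.CriticalPhenomena

/-! ### One-arm probabilities along parameters converging to a zero of `θ` (any dimension) -/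

/-- If `θ(p₀) = 0` on `ℤ^d`, then along any parameters `q_k → p₀` and any scales `n_k → ∞` the
one-arm probabilities `P_{q_k}(0 ↔ ∂Λ_{n_k})` tend to `0`: choose a fixed scale `K` with
`P_{p₀}(0 ↔ ∂Λ_K) < ε/2` (else `ε/2 ≤ θ(p₀)`), use continuity of the local event `{0 ↔ ∂Λ_K}` in
the parameter and `P_q(0 ↔ ∂Λ_n) ≤ P_q(0 ↔ ∂Λ_K)` for `n ≥ K`. -/
theorem tendsto_real_siteToBoundary_of_theta_eq_zero {d : ℕ} {p₀ : unitInterval}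
    (h0 : theta (zdGraph d) 0 p₀ = 0) {q : ℕ → unitInterval} (hq : Tendsto q atTop (𝓝 p₀))
    {n : ℕ → ℕ} (hn : Tendsto n atTop atTop) :
    Tendsto (fun k => (bondPercolation (zdGraph d) (q k)).real (siteToBoundary d (n k)))
      atTop (𝓝 0) := by
  rw [Metric.tendsto_nhds]
  intro ε hε
  obtain ⟨K, hK⟩ : ∃ K, (bondPercolation (zdGraph d) p₀).real (siteToBoundary d K) < ε / 2 := by
    by_contra hcon
    push Not at hcon
    have := DCT16.le_theta_of_forall_le_real_siteToBoundary p₀ hcon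
    linarith
  have hcont := (continuous_bondPercolation_real_of_determinedBy (zdGraph d)
    (DCT16.determinedBy_siteToBoundary d K)).tendsto p₀
  have hev₁ : ∀ᶠ k in atTop,
      (bondPercolation (zdGraph d) (q k)).real (siteToBoundary d K) < ε :=
    (hcont.comp hq).eventually (gt_mem_nhds (by linarith))
  have hev₂ : ∀ᶠ k in atTop, K ≤ n k := hn.eventually_ge_atTop K
  filter_upwards [hev₁, hev₂] with k h₁ h₂
  rw [Real.dist_0_eq_abs, abs_of_nonneg measureReal_nonneg]
  exact (DCT16.real_siteToBoundary_antitone (q k) h₂).trans_lt h₁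

/-- Conversely, if `q_k ≥ p₀` and `P_{q_k}(0 ↔ ∂Λ_{n_k}) → 0` then `θ(p₀) = 0`, since
`θ(p₀) ≤ θ(q_k) ≤ P_{q_k}(0 ↔ ∂Λ_{n_k})`. -/
theorem theta_eq_zero_of_tendsto_real_siteToBoundary {d : ℕ} {p₀ : unitInterval}
    {q : ℕ → unitInterval} (hle : ∀ k, p₀ ≤ q k) {n : ℕ → ℕ}
    (h : Tendsto (fun k => (bondPercolation (zdGraph d) (q k)).real (siteToBoundary d (n k)))
      atTop (𝓝 0)) :
    theta (zdGraph d) 0 p₀ = 0 := by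
  refine le_antisymm ?_ measureReal_nonneg
  refine le_of_tendsto_of_tendsto' tendsto_const_nhds h fun k => ?_
  exact (theta_mono_holds (zdGraph d) 0 (hle k)).trans
    (DCT16.theta_le_real_siteToBoundary (q k) (n k))

/-- **`θ(p₀) = 0 ↔ P_{q_k}(0 ↔ ∂Λ_{n_k}) → 0`** for any `q_k → p₀` with `q_k ≥ p₀` and any
`n_k → ∞` (bond percolation on `ℤ^d`). -/
theorem theta_eq_zero_iff_tendsto_real_siteToBoundary {d : ℕ} {p₀ : unitInterval}
    {q : ℕ → unitInterval} (hq : Tendsto q atTop (𝓝 p₀)) (hle : ∀ k, p₀ ≤ q k)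
    {n : ℕ → ℕ} (hn : Tendsto n atTop atTop) :
    theta (zdGraph d) 0 p₀ = 0 ↔
      Tendsto (fun k => (bondPercolation (zdGraph d) (q k)).real (siteToBoundary d (n k)))
        atTop (𝓝 0) :=
  ⟨fun h0 => tendsto_real_siteToBoundary_of_theta_eq_zero h0 hq hn,
    theta_eq_zero_of_tendsto_real_siteToBoundary hle⟩

/-! ### The slab-critical staircase and the one-arm form -/

/-- `p_c(C_k) → p_c(ℤ³)` in `[0, 1]`. -/
theorem tendsto_criticalProbIOf_cslab :
    Tendsto (fun k : ℕ => criticalProbIOf (cslabGraph k) (cslabOrigin k)) atTop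
      (𝓝 (criticalProbI 3)) :=
  tendsto_subtype_rng.2 tendsto_criticalProb_cslab

/-- **`θ(p_c(ℤ³)) = 0 ↔ P_{p_c(C_k)}(0 ↔ ∂Λ_k) → 0`**: the conjunct is the vanishing of the
one-arm probability at scale `k` evaluated at the critical point of the centred slab of
half-width `k`. -/
theorem percolationContinuityZ3_iff_tendsto_oneArm_slabCritical :
    PercolationContinuityZ3 ↔
      Tendsto (fun k : ℕ => (bondPercolation (zdGraph 3)
        (criticalProbIOf (cslabGraph k) (cslabOrigin k))).real (siteToBoundary 3 k))
        atTop (𝓝 0) :=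
  theta_eq_zero_iff_tendsto_real_siteToBoundary tendsto_criticalProbIOf_cslab
    (fun k => criticalProb_le_criticalProb_cslab k) tendsto_id

/-! ### The vertical crossing of the critical slab from its centre -/

/-- `{0 ↔ ∂C_k in C_k}`: the origin is joined by an open path INSIDE the centred slab `C_k` to a
site of one of its two faces `{x₀ = k}`, `{x₀ = -k}`. -/
def slabCross (k : ℕ) : Set (BondConfig (Site 3)) :=
  {ω | ∃ y : Site 3, (y 0 = (k : ℤ) ∨ y 0 = -(k : ℤ)) ∧ ω ∈ openConnIn (cslab k) 0 y}

/-- **`{0 ↔ ∞} ⊆ {0 ↔ ∞ in C_k} ∪ {0 ↔ ∂C_k in C_k}`** (for `ω ⊆ E(ℤ³)`): if the cluster of `0` is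
infinite but its slab cluster `{y : 0 ↔ y in C_k}` is finite, an open path from `0` to a point
outside the slab cluster has a first edge `a ∼ b` leaving it; `b` cannot lie in `C_k` (else the
step would extend the slab cluster), so `a` lies on a face, and the initial segment up to `a`
runs inside the slab cluster, hence inside `C_k`. -/
theorem mem_slabCross_of_percolatesAt_of_notMem_slabPerc (k : ℕ) {ω : BondConfig (Site 3)}
    (hω : ω ⊆ (zdGraph 3).edgeSet) (hperc : ω ∈ percolatesAt (0 : Site 3))
    (hslab : ω ∉ slabPerc k) : ω ∈ slabCross k := by
  have hslab' : ¬ (openClusterIn (cslabSteps k) ω 0).Infinite := hslab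
  have hfin : (openClusterIn (cslabSteps k) ω 0).Finite := Set.not_infinite.1 hslab'
  have hinf : (openCluster ω (0 : Site 3)).Infinite := hperc
  obtain ⟨z, hz, hzR⟩ :
      ∃ z ∈ openCluster ω (0 : Site 3), z ∉ openClusterIn (cslabSteps k) ω 0 := by
    by_contra hcon
    push Not at hcon
    exact hinf (hfin.subset hcon)
  obtain ⟨a, b, ha, hb, -, hab, hpa⟩ :=
    (DCT16.pathIn_univ_of_reachable hz).exit (self_mem_openClusterIn (cslabSteps k) ω 0) hzR
  have hRsub : openClusterIn (cslabSteps k) ω 0 ⊆ cslab k :=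
    openClusterIn_withinGraph_subset (zero_mem_cslab k) ω
  have hadj : (zdGraph 3).Adj a b := DCT16.adj_of_openGraph_adj hω hab
  have haS : a ∈ cslab k := hRsub ha
  have hbS : b ∉ cslab k := fun hbS =>
    hb (mem_openClusterIn_of_adj ha (withinGraph_adj.2 ⟨hadj, haS, hbS⟩)
      ((openGraph_adj ω a b).1 hab).1)
  refine ⟨a, ?_, DCT16.mem_openConnIn_of_pathIn (hpa.mono (Set.inter_subset_left.trans hRsub))⟩
  have h1 := DCT16.abs_sub_le_one_of_adj hadj 0
  simp only [cslab, Set.mem_setOf_eq, not_and_or, not_le] at haS hbS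
  rw [abs_le] at h1
  omega

/-- **`{0 ↔ ∂C_k in C_k} ⊆ {0 ↔ ∂Λ_k}`** (for `ω ⊆ E(ℤ³)`): a face site has a coordinate of
absolute value `k`, so it is not interior to `Λ_k`; stop the path at its first exit from `Λ_k`. -/
theorem mem_siteToBoundary_of_mem_slabCross (k : ℕ) {ω : BondConfig (Site 3)}
    (hω : ω ⊆ (zdGraph 3).edgeSet) (h : ω ∈ slabCross k) : ω ∈ siteToBoundary 3 k := by
  obtain ⟨y, hy, hconn⟩ := h
  rw [← DCT16.armEvent_zero]
  refine DCT16.armEvent_of_pathIn hω (DCT16.pathIn_of_mem_openConnIn hconn) ?_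
  rw [sub_zero]
  by_cases hyb : y ∈ box 3 k
  · exact Or.inr (DCT16.mem_innerBoundary_box_of_natAbs_eq hyb (i := 0) (by omega))
  · exact Or.inl hyb

/-- **`θ_{ℤ³}(p) - θ_{C_k}(p) ≤ P_p(0 ↔ ∂C_k in C_k)`** for every `p` and `k`: the slab defect is at
most the probability of crossing the slab vertically from the centre. -/
theorem theta_sub_theta_cslab_le_real_slabCross (k : ℕ) (p : unitInterval) :
    theta (zdGraph 3) (0 : Site 3) p - theta (cslabGraph k) (cslabOrigin k) p ≤
      (bondPercolation (zdGraph 3) p).real (slabCross k) := by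
  have h1 : (bondPercolation (zdGraph 3) p).real (percolatesAt (0 : Site 3)) ≤
      (bondPercolation (zdGraph 3) p).real (slabPerc k ∪ slabCross k) :=
    DCT16.real_mono_of_forall_subset_edgeSet (zdGraph 3) p fun ω hω hperc => by
      by_cases hs : ω ∈ slabPerc k
      · exact Or.inl hs
      · exact Or.inr (mem_slabCross_of_percolatesAt_of_notMem_slabPerc k hω hperc hs)
  have h2 := measureReal_union_le (μ := bondPercolation (zdGraph 3) p) (slabPerc k) (slabCross k)
  rw [← real_slabPerc, theta]
  linarith

/-- `P_p(0 ↔ ∂C_k in C_k) ≤ P_p(0 ↔ ∂Λ_k)`. -/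
theorem real_slabCross_le_real_siteToBoundary (k : ℕ) (p : unitInterval) :
    (bondPercolation (zdGraph 3) p).real (slabCross k) ≤
      (bondPercolation (zdGraph 3) p).real (siteToBoundary 3 k) :=
  DCT16.real_mono_of_forall_subset_edgeSet (zdGraph 3) p fun _ω hω h =>
    mem_siteToBoundary_of_mem_slabCross k hω h

/-- **`a_k ≤ P_{p_k}(0 ↔ ∂C_k in C_k)`** for `k ≥ 1`: at the slab's own critical point the slab
term vanishes (DST), so the whole density of `ℤ³` at `p_k` is carried by vertical crossings. -/
theorem theta_slabCritical_le_real_slabCross (k : ℕ) (hk : 0 < k) :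
    theta (zdGraph 3) (0 : Site 3) (criticalProbIOf (cslabGraph k) (cslabOrigin k)) ≤
      (bondPercolation (zdGraph 3) (criticalProbIOf (cslabGraph k) (cslabOrigin k))).real
        (slabCross k) := by
  have h := theta_sub_theta_cslab_le_real_slabCross k
    (criticalProbIOf (cslabGraph k) (cslabOrigin k))
  rw [theta_cslab_criticalProb_eq_zero k hk, sub_zero] at h
  exact h

/-- **`θ(p_c(ℤ³)) ≤ P_{p_c(C_k)}(0 ↔ ∂C_k in C_k)`** for `k ≥ 1`: in the jump world the critical
slabs are crossed vertically from the centre with probability bounded below, uniformly in the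
width. -/
theorem theta_criticalProbI_le_real_slabCross (k : ℕ) (hk : 0 < k) :
    theta (zdGraph 3) (0 : Site 3) (criticalProbI 3) ≤
      (bondPercolation (zdGraph 3) (criticalProbIOf (cslabGraph k) (cslabOrigin k))).real
        (slabCross k) :=
  (theta_criticalProbI_le_theta_slabCritical k).trans (theta_slabCritical_le_real_slabCross k hk)

/-- **`θ(p_c(ℤ³)) = 0 ↔ P_{p_c(C_k)}(0 ↔ ∂C_k in C_k) → 0`**: the conjunct is EQUIVALENT to the
statement that the centred slab of half-width `k`, at its own critical point, is crossed
vertically from its centre with probability tending to `0` as `k → ∞`. (→): the crossing forces a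
one-arm to distance `k`, and `percolationContinuityZ3_iff_tendsto_oneArm_slabCritical`;
(←): `a_k ≤ P_{p_k}(0 ↔ ∂C_k in C_k)` for `k ≥ 1` and `percolationContinuityZ3_iff_tendsto_theta_slabCritical`. -/
theorem percolationContinuityZ3_iff_tendsto_real_slabCross :
    PercolationContinuityZ3 ↔
      Tendsto (fun k : ℕ => (bondPercolation (zdGraph 3)
        (criticalProbIOf (cslabGraph k) (cslabOrigin k))).real (slabCross k)) atTop (𝓝 0) := by
  constructor
  · intro h
    exact squeeze_zero (fun _ => measureReal_nonneg)
      (fun k => real_slabCross_le_real_siteToBoundary k _)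
      (percolationContinuityZ3_iff_tendsto_oneArm_slabCritical.1 h)
  · intro h
    refine percolationContinuityZ3_iff_tendsto_theta_slabCritical.2 ?_
    refine squeeze_zero' (Eventually.of_forall fun _ => measureReal_nonneg) ?_ h
    exact eventually_atTop.2 ⟨1, fun k hk => theta_slabCritical_le_real_slabCross k hk⟩

end Summit.CriticalPhenomena.PercolationContinuityZ3.Theorems

end
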